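import Summits.HodgeConjecture.CorCM.DihedralReflexTripleCMHodge
import Summits.HodgeConjecture.CorCM.CMBalancedWeightSplitting
import HarnessLib

/-!
# The dihedral surface triple in all degrees: `S₁ × S₂ × S₁′` carries exceptional Hodge classes EXACTLY in
# `H⁴`, `H⁶`, `H⁸` — in degrees `p ∉ {2, 3, 4}` every Hodge class is a product of divisor classes, hence algebraic

COR-CM (cell `pub-hodgecm2`, seat p2 gen 19, count-neutral claim DIHEDRAL-TRIPLE, sequel of
`DihedralReflexTripleCMHodge`); NEW as stated, hence under `Summits/`.  Theorems only; no definition, no named fact,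
no `sorry`.  The CM-type / realisation form of the degree profile `0, 0, 4, 8, 4, 0, 0` of the kernel census
`Census/DihedralSurfaceTripleDegrees` (seat b20; not imported): for EVERY non-Galois quartic CM field, every
reflex-class partner, all types and all realisations, the Pohlmann sets of the triple that are not disjoint unions of
balanced pairs occur exactly in degrees `p = 2, 3, 4`.

* §1 GENERIC BOOKKEEPING for a family `Φ` over `Fin n` (any CM fields): a Galois-balanced weight stable under complex
  conjugation is a disjoint union of conjugate pairs (`mem_pohlmannDivisorSetsAlg_of_conj_smul_mem`); the full index set
  is balanced (`isGaloisBalancedAlg_univ`) and complements of Pohlmann sets are Pohlmann sets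
  (`compl_mem_pohlmannSetsAlg`); for a SEPARATING family the divisor sets are stable under conjugation
  (`conj_smul_mem_iff_of_mem_pohlmannDivisorSetsAlg`, via `CMAlgebra.slotProj_eq_conj_of_pair_mem_pohlmannSetsAlg_one`), so
  «exceptional» = «balanced and not conjugation-stable» (`mem_diff_iff_not_conj_stable`); exceptional sets in degree `p`
  give exceptional sets in the complementary degree and, when a conjugate pair avoids them, in degree `p + 1`.
* §2 THE TRIPLE (`Σ_j [K_j:ℚ] = 12`): **`diff_nonempty_iff`** — `(pohlmannSetsAlg Φ p ∖ pohlmannDivisorSetsAlg Φ p) ≠ ∅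
  ⟺ 2 ≤ p ≤ 4` (degree `2` is `pohlmannSetsAlg_two_diff_nonempty`; `3` by adjoining a conjugate pair, `4` by
  complement; `0, 1, 5, 6` excluded: a balanced pair of a separating family is a conjugate pair, and complements).
* §3 ON ABELIAN VARIETIES, for every family of realisations `A`: **`exists_exceptional_biproduct_iff_degree`** — a rational
  `(p,p)`-class on `⨁ A = S₁ × S₂ × S₁′` outside `Dᵖ ⊗ ℂ` exists iff `2 ≤ p ≤ 4`; **`hodgeClassSpan_eq_divisorClassesSpan`**
  and **`hodgeClasses_algebraic`** for `p ≤ 1` or `5 ≤ p` — the Hodge conjecture for `S₁ × S₂ × S₁′` is EXACTLY the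
  algebraicity of its exceptional classes in `H⁴, H⁶, H⁸` (open; toy census: `4 + 8 + 4` classes).

## References
* [Pohlmann1968] H. Pohlmann, Ann. of Math. 88 (1968) 161–180, Thm. 1.
* [Gordon1999HodgeAVSurvey] B. B. Gordon, *A survey of the Hodge conjecture for abelian varieties*, 9.2.2, §9.3.
* [MoonenZarhin1999LowDim] B. Moonen, Yu. Zarhin, Math. Ann. 315 (1999) 711–733, "Hodge groups of simple abelian
  surfaces of CM-type".
-/

noncomputable section

open CategoryTheory CategoryTheory.Limits NumberField NumberField.ComplexEmbedding IntermediateField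
open scoped BigOperators Pointwise

namespace Summit.HodgeConjecture.CorCM

open Literature.NumberTheory.ComplexMultiplication
open Literature.NumberTheory.ComplexMultiplication.CMTypeOps (mem_iff_conjugate_notMem conjugate_mem_iff_notMem)
open Literature.AlgebraicGeometry.Motives (AbelianVariety CMType)
open Literature.AlgebraicGeometry.HodgeTheory
open Literature.AlgebraicGeometry.ComplexMultiplication (IsCMTypeRealisation)
open Literature.AlgebraicGeometry.VanGeemen1994 (hodgeClassSpan)
open Literature.AlgebraicGeometry.Pohlmann1968
open Literature.Barriers.HodgeConjecture (divisorClassesSpan)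
open CMWeights QuarticCMPairs

namespace DihedralReflexTriple
/-! ### §1 Generic bookkeeping: conjugation-stable balanced weights, the full set, complements -/

section Generic

variable {n : ℕ} {K : Fin n → Type} [∀ i, Field (K i)] [∀ i, NumberField (K i)] [∀ i, IsCMField (K i)]

open scoped Classical in
/-- **A Galois-balanced weight stable under complex conjugation is a disjoint union of conjugate pairs**, hence a
Pohlmann divisor set (induction: split off `{x, x̄}`, which is balanced, `CMWeights.isGaloisBalancedAlg_pair_conj`).
[cite: Gordon1999HodgeAVSurvey, 9.2.2] -/
theorem mem_pohlmannDivisorSetsAlg_of_conj_smul_mem (Φ : ∀ i, CMType (K i)) :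
    ∀ (S : Finset ((i : Fin n) × (K i →+* ℂ))), IsGaloisBalancedAlg Φ S →
      (∀ x ∈ S, (starRingAut : ℂ ≃+* ℂ) • x ∈ S) → S ∈ pohlmannDivisorSetsAlg Φ (S.card / 2) := by
  intro S
  induction S using Finset.strongInduction with
  | H S ih =>
    intro hS hst
    rcases S.eq_empty_or_nonempty with rfl | ⟨x, hx⟩
    · rw [Finset.card_empty, pohlmannDivisorSetsAlg_def, mem_disjointUnionsOf_zero]
    · -- split off the conjugate pair `t = {x, x̄}`
      set t : Finset ((i : Fin n) × (K i →+* ℂ)) :=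
        {x} ∪ (starRingAut : ℂ ≃+* ℂ) • ({x} : Finset ((i : Fin n) × (K i →+* ℂ))) with ht_def
      have htx : t = {x, (starRingAut : ℂ ≃+* ℂ) • x} := by
        rw [ht_def, Finset.smul_finset_singleton, Finset.insert_eq]
      have htbal : IsGaloisBalancedAlg Φ t := isGaloisBalancedAlg_pair_conj Φ x
      have htcard : t.card = 2 := by
        rw [htx, Finset.card_pair (conj_smul_ne_self Φ x).symm]
      have htS : t ⊆ S := by
        intro y hy
        rw [htx, Finset.mem_insert, Finset.mem_singleton] at hy
        rcases hy with rfl | rfl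
        · exact hx
        · exact hst _ hx
      have hdisj : Disjoint t (S \ t) := Finset.disjoint_sdiff
      have hunion : t ∪ (S \ t) = S := Finset.union_sdiff_of_subset htS
      have hS2 : IsGaloisBalancedAlg Φ (t ∪ (S \ t)) := by
        rw [hunion]
        exact hS
      have hS'bal : IsGaloisBalancedAlg Φ (S \ t) := isGaloisBalancedAlg_of_union_left hS2 htbal hdisj
      have hS'st : ∀ y ∈ S \ t, (starRingAut : ℂ ≃+* ℂ) • y ∈ S \ t := by
        intro y hy
        rw [Finset.mem_sdiff] at hy ⊢
        refine ⟨hst y hy.1, fun hyt => hy.2 ?_⟩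
        rw [htx, Finset.mem_insert, Finset.mem_singleton] at hyt ⊢
        rcases hyt with h | h
        · right
          rw [← h, conj_smul_conj_smul]
        · left
          exact MulAction.injective (starRingAut : ℂ ≃+* ℂ) h
      have hlt : S \ t ⊂ S := Finset.sdiff_ssubset htS (by rw [htx]; exact Finset.insert_nonempty _ _)
      have hmem := ih (S \ t) hlt hS'bal hS'st
      have hcard : S.card / 2 = (S \ t).card / 2 + 1 := by
        rw [Finset.card_sdiff_of_subset htS, htcard]
        have h2 : 2 ≤ S.card := htcard ▸ Finset.card_le_card htS
        omega
      rw [hcard, pohlmannDivisorSetsAlg_def, mem_disjointUnionsOf_succ]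
      refine ⟨S \ t, (pohlmannDivisorSetsAlg_def Φ _) ▸ hmem, t, ⟨htcard, htbal⟩, hdisj.symm, ?_⟩
      rw [Finset.disjUnion_eq_union, Finset.sdiff_union_of_subset htS]

open scoped Classical in
/-- **The full index set `⊔_i Hom(K_i, ℂ)` is Galois-balanced** (`x ↦ x̄` exchanges the members inside and outside every
translate of the type). [cite: Gordon1999HodgeAVSurvey, §9.3] -/
theorem isGaloisBalancedAlg_univ (Φ : ∀ i, CMType (K i)) :
    IsGaloisBalancedAlg Φ (Finset.univ : Finset ((i : Fin n) × (K i →+* ℂ))) := by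
  intro τ
  have h := ncard_sep_conj_smul_mem Φ τ (Finset.univ : Finset ((i : Fin n) × (K i →+* ℂ)))
  rwa [Finset.smul_finset_univ] at h

open scoped Classical in
/-- **Complements of Pohlmann sets are Pohlmann sets**: if `|⊔_i Hom(K_i, ℂ)| = 2N` and `S` is a balanced `2p`-set then
`univ ∖ S` is a balanced `2(N − p)`-set (Poincaré duality on the index sets). [cite: Gordon1999HodgeAVSurvey, §9.3] -/
theorem compl_mem_pohlmannSetsAlg (Φ : ∀ i, CMType (K i)) {N p : ℕ}
    (hN : Fintype.card ((i : Fin n) × (K i →+* ℂ)) = 2 * N) {S : Finset ((i : Fin n) × (K i →+* ℂ))}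
    (hS : S ∈ pohlmannSetsAlg Φ p) : Finset.univ \ S ∈ pohlmannSetsAlg Φ (N - p) := by
  refine ⟨?_, ?_⟩
  · rw [Finset.card_sdiff_of_subset (Finset.subset_univ S), Finset.card_univ, hN, hS.1]
    omega
  · have hunion : S ∪ (Finset.univ \ S) = Finset.univ := Finset.union_sdiff_of_subset (Finset.subset_univ S)
    have h2 : IsGaloisBalancedAlg Φ (S ∪ (Finset.univ \ S)) := by
      rw [hunion]
      exact isGaloisBalancedAlg_univ Φ
    exact isGaloisBalancedAlg_of_union_left h2 hS.2 Finset.disjoint_sdiff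

open scoped Classical in
/-- For a SEPARATING family a balanced pair is a conjugate pair `{a, ā}`
(`CMAlgebra.slotProj_eq_conj_of_pair_mem_pohlmannSetsAlg_one` on the identity slot map).
[cite: Gordon1999HodgeAVSurvey, 9.2.2 and 7.4] -/
theorem eq_conj_smul_of_pair_mem_pohlmannSetsAlg_one {Φ : ∀ i, CMType (K i)}
    (hsep : CMAlgebra.IsSeparatingFamily Φ) {a b : (i : Fin n) × (K i →+* ℂ)} (hab : a ≠ b)
    (h : ({a, b} : Finset ((i : Fin n) × (K i →+* ℂ))) ∈ pohlmannSetsAlg Φ 1) :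
    b = (starRingAut : ℂ ≃+* ℂ) • a := by
  have h' := CMAlgebra.slotProj_eq_conj_of_pair_mem_pohlmannSetsAlg_one (K := K) (Φ := Φ) hsep
    (fun j : Fin n => j) hab h
  rw [CMAlgebra.slotProj_apply, ← conj_smul_sigma_eq] at h'
  exact h'

open scoped Classical in
/-- **For a SEPARATING family, divisor sets are stable under complex conjugation** (they are disjoint unions of
conjugate pairs). [cite: Gordon1999HodgeAVSurvey, 9.2.2 and 7.4] -/
theorem conj_smul_mem_iff_of_mem_pohlmannDivisorSetsAlg {Φ : ∀ i, CMType (K i)} (hsep : CMAlgebra.IsSeparatingFamily Φ)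
    {m : ℕ} {U : Finset ((i : Fin n) × (K i →+* ℂ))} (hU : U ∈ pohlmannDivisorSetsAlg Φ m)
    (y : (i : Fin n) × (K i →+* ℂ)) : (starRingAut : ℂ ≃+* ℂ) • y ∈ U ↔ y ∈ U := by
  revert y
  rw [pohlmannDivisorSetsAlg_def] at hU
  refine disjointUnionsOf_induction
    (P := fun U : Finset ((i : Fin n) × (K i →+* ℂ)) => ∀ y, (starRingAut : ℂ ≃+* ℂ) • y ∈ U ↔ y ∈ U)
    (fun y => by simp) (fun V t hV ht hVt y => ?_) hU
  obtain ⟨a, b, hab, rfl⟩ := Finset.card_eq_two.1 ht.1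
  have hb := eq_conj_smul_of_pair_mem_pohlmannSetsAlg_one hsep hab ht
  subst hb
  have e1 : (starRingAut : ℂ ≃+* ℂ) • y = a ↔ y = (starRingAut : ℂ ≃+* ℂ) • a :=
    ⟨fun h => by rw [← h, conj_smul_conj_smul], fun h => by rw [h, conj_smul_conj_smul]⟩
  have e2 : (starRingAut : ℂ ≃+* ℂ) • y = (starRingAut : ℂ ≃+* ℂ) • a ↔ y = a :=
    ⟨fun h => MulAction.injective (starRingAut : ℂ ≃+* ℂ) h, fun h => by rw [h]⟩
  rw [Finset.mem_disjUnion, Finset.mem_disjUnion, hV y, Finset.mem_insert, Finset.mem_singleton, Finset.mem_insert,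
    Finset.mem_singleton, e1, e2]
  refine ⟨?_, ?_⟩ <;> rintro (h | h | h)
  exacts [Or.inl h, Or.inr (Or.inr h), Or.inr (Or.inl h), Or.inl h, Or.inr (Or.inr h), Or.inr (Or.inl h)]

open scoped Classical in
/-- **Exceptional = balanced and not conjugation-stable** (separating family): a Pohlmann `2p`-set lies outside the divisor
sets iff some member has its conjugate outside. [cite: Gordon1999HodgeAVSurvey, 9.2.2] -/
theorem mem_diff_iff_not_conj_stable {Φ : ∀ i, CMType (K i)} (hsep : CMAlgebra.IsSeparatingFamily Φ) {p : ℕ}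
    {S : Finset ((i : Fin n) × (K i →+* ℂ))} (hS : S ∈ pohlmannSetsAlg Φ p) :
    S ∈ pohlmannSetsAlg Φ p \ pohlmannDivisorSetsAlg Φ p ↔ ∃ x ∈ S, (starRingAut : ℂ ≃+* ℂ) • x ∉ S := by
  constructor
  · rintro ⟨-, hD⟩
    by_contra h
    push Not at h
    have hp : S.card / 2 = p := by rw [hS.1]; omega
    exact hD (hp ▸ mem_pohlmannDivisorSetsAlg_of_conj_smul_mem Φ S hS.2 h)
  · rintro ⟨x, hx, hx'⟩
    exact ⟨hS, fun hD => hx' ((conj_smul_mem_iff_of_mem_pohlmannDivisorSetsAlg hsep hD x).2 hx)⟩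

open scoped Classical in
/-- **Complementary degree.**  An exceptional Pohlmann `2p`-set has an exceptional complement, of degree `N − p`
(`|⊔_i Hom(K_i, ℂ)| = 2N`). [cite: Gordon1999HodgeAVSurvey, §9.3] -/
theorem compl_mem_diff {Φ : ∀ i, CMType (K i)} (hsep : CMAlgebra.IsSeparatingFamily Φ) {N p : ℕ}
    (hN : Fintype.card ((i : Fin n) × (K i →+* ℂ)) = 2 * N) {S : Finset ((i : Fin n) × (K i →+* ℂ))}
    (hS : S ∈ pohlmannSetsAlg Φ p \ pohlmannDivisorSetsAlg Φ p) :
    Finset.univ \ S ∈ pohlmannSetsAlg Φ (N - p) \ pohlmannDivisorSetsAlg Φ (N - p) := by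
  have hc := compl_mem_pohlmannSetsAlg Φ hN hS.1
  obtain ⟨x, hx, hx'⟩ := (mem_diff_iff_not_conj_stable hsep hS.1).1 hS
  refine (mem_diff_iff_not_conj_stable hsep hc).2 ⟨(starRingAut : ℂ ≃+* ℂ) • x, ?_, ?_⟩
  · rw [Finset.mem_sdiff]
    exact ⟨Finset.mem_univ _, hx'⟩
  · rw [conj_smul_conj_smul, Finset.mem_sdiff, not_and, not_not]
    exact fun _ => hx

open scoped Classical in
/-- **One degree up.**  An exceptional Pohlmann `2p`-set disjoint from some conjugate pair `{y, ȳ}` gives an exceptional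
`2(p+1)`-set `S ⊔ {y, ȳ}`. [cite: Gordon1999HodgeAVSurvey, 9.2.2] -/
theorem union_pair_mem_diff {Φ : ∀ i, CMType (K i)} (hsep : CMAlgebra.IsSeparatingFamily Φ) {p : ℕ}
    {S : Finset ((i : Fin n) × (K i →+* ℂ))} (hS : S ∈ pohlmannSetsAlg Φ p \ pohlmannDivisorSetsAlg Φ p)
    {y : (i : Fin n) × (K i →+* ℂ)} (hy : y ∉ S) (hy' : (starRingAut : ℂ ≃+* ℂ) • y ∉ S) :
    S ∪ ({y} ∪ (starRingAut : ℂ ≃+* ℂ) • ({y} : Finset ((i : Fin n) × (K i →+* ℂ)))) ∈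
      pohlmannSetsAlg Φ (p + 1) \ pohlmannDivisorSetsAlg Φ (p + 1) := by
  set t : Finset ((i : Fin n) × (K i →+* ℂ)) :=
    {y} ∪ (starRingAut : ℂ ≃+* ℂ) • ({y} : Finset ((i : Fin n) × (K i →+* ℂ))) with ht_def
  have hty : t = {y, (starRingAut : ℂ ≃+* ℂ) • y} := by
    rw [ht_def, Finset.smul_finset_singleton, Finset.insert_eq]
  have hdisj : Disjoint S t := by
    rw [hty, Finset.disjoint_insert_right, Finset.disjoint_singleton_right]
    exact ⟨hy, hy'⟩
  have hmem : S ∪ t ∈ pohlmannSetsAlg Φ (p + 1) := by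
    refine ⟨?_, isGaloisBalancedAlg_union hS.1.2 (isGaloisBalancedAlg_pair_conj Φ y) hdisj⟩
    rw [Finset.card_union_of_disjoint hdisj, hS.1.1, hty, Finset.card_pair (conj_smul_ne_self Φ y).symm]
    ring
  obtain ⟨x, hx, hx'⟩ := (mem_diff_iff_not_conj_stable hsep hS.1).1 hS
  refine (mem_diff_iff_not_conj_stable hsep hmem).2 ⟨x, Finset.mem_union_left _ hx, ?_⟩
  rw [Finset.mem_union, not_or]
  refine ⟨hx', fun hxt => ?_⟩
  rw [hty, Finset.mem_insert, Finset.mem_singleton] at hxt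
  rcases hxt with h | h
  · exact hy' (by rw [← h, conj_smul_conj_smul]; exact hx)
  · exact hy (MulAction.injective (starRingAut : ℂ ≃+* ℂ) h ▸ hx)

open scoped Classical in
/-- **No exceptional sets in degrees `0, 1` and `N − 1, N` (and beyond)** for a separating family on `2N` embeddings: a
balanced pair is a conjugate pair (`CMAlgebra.slotProj_eq_conj_of_pair_mem_pohlmannSetsAlg_one`), and complements.
[cite: Gordon1999HodgeAVSurvey, 9.2.2 and 7.4] -/
theorem diff_eq_empty_of_degree {Φ : ∀ i, CMType (K i)} (hsep : CMAlgebra.IsSeparatingFamily Φ) {N p : ℕ}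
    (hN : Fintype.card ((i : Fin n) × (K i →+* ℂ)) = 2 * N) (hp : p ≤ 1 ∨ N ≤ p + 1) :
    pohlmannSetsAlg Φ p \ pohlmannDivisorSetsAlg Φ p = ∅ := by
  -- degree `≤ 1`: directly; degree `≥ N - 1`: through the complement
  have low : ∀ (q : ℕ) (S : Finset ((i : Fin n) × (K i →+* ℂ))), q ≤ 1 →
      S ∉ pohlmannSetsAlg Φ q \ pohlmannDivisorSetsAlg Φ q := by
    intro q S hq hS
    obtain ⟨x, hx, hx'⟩ := (mem_diff_iff_not_conj_stable hsep hS.1).1 hS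
    have hcard : S.card = 2 * q := hS.1.1
    interval_cases q
    · have h0 : S = ∅ := Finset.card_eq_zero.1 (by omega)
      rw [h0] at hx
      exact Finset.notMem_empty _ hx
    · obtain ⟨a, b, hab, rfl⟩ := Finset.card_eq_two.1 (by omega)
      rw [Finset.mem_insert, Finset.mem_singleton] at hx
      rcases hx with rfl | rfl
      · exact hx' (by rw [← eq_conj_smul_of_pair_mem_pohlmannSetsAlg_one hsep hab hS.1]; simp)
      · have h2 := eq_conj_smul_of_pair_mem_pohlmannSetsAlg_one hsep hab.symm (by rw [Finset.pair_comm]; exact hS.1)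
        exact hx' (by rw [← h2]; simp)
  rcases hp with hp | hp
  · exact Set.eq_empty_iff_forall_notMem.2 fun S hS => low p S hp hS
  · refine Set.eq_empty_iff_forall_notMem.2 fun S hS => ?_
    have hpN : p ≤ N := by
      have h := hS.1.1 ▸ Finset.card_le_univ S
      rw [hN] at h
      omega
    exact low (N - p) _ (by omega) (compl_mem_diff hsep hN hS)

end Generic
/-! ### §2 The degree profile of the dihedral surface triple -/

section Triple

variable {K : Fin 3 → Type} [∀ j, Field (K j)] [∀ j, NumberField (K j)] [∀ j, IsCMField (K j)]

omit [∀ j, IsCMField (K j)] in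
/-- `|Hom(K₀, ℂ) ⊔ Hom(K₁, ℂ) ⊔ Hom(K₂, ℂ)| = 12 = 2 · 6`. [folklore] -/
theorem card_sigma_eq_twelve (h4₀ : Module.finrank ℚ (K 0) = 4) (h4₁ : Module.finrank ℚ (K 1) = 4)
    (e : K 2 ≃+* K 0) : Fintype.card ((j : Fin 3) × (K j →+* ℂ)) = 2 * 6 := by
  have h4₂ : Module.finrank ℚ (K 2) = 4 :=
    ((AlgEquiv.ofRingEquiv (f := e) fun q => by simp).toLinearEquiv.finrank_eq).trans h4₀
  rw [Fintype.card_sigma, Fin.sum_univ_three, Embeddings.card, Embeddings.card, Embeddings.card, h4₀, h4₁, h4₂]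

open scoped Classical in
/-- **The degree profile.**  For the dihedral surface triple (hypotheses of `pohlmannSetsAlg_two_diff_nonempty`), the
Pohlmann `2p`-sets outside the divisor sets exist EXACTLY for `2 ≤ p ≤ 4`: degree `2` is the exceptional `4`-set of
`DihedralReflexTripleCMHodge`; it misses some conjugate pair (it has `4` members, there are `6` pairs), which gives degree
`3`; its complement gives degree `4`; degrees `0, 1, 5, 6` carry none (balanced pairs are conjugate pairs; complements),
and `p ≥ 7` is empty.  Toy census: `0, 0, 4, 8, 4, 0, 0`. [cite: Pohlmann1968, Thm. 1] [cite: Gordon1999HodgeAVSurvey,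
9.2.2 and §9.3] -/
theorem diff_nonempty_iff (h4₀ : Module.finrank ℚ (K 0) = 4) (hK₀ : ¬IsGalois ℚ (K 0))
    (h4₁ : Module.finrank ℚ (K 1) = 4) (hK₁ : ¬IsGalois ℚ (K 1))
    (hMK : ∀ (t : K 1 →+* ℂ) (y : K 1), t y ∈ normalClosure ℚ (K 0) ℂ) (hne : IsEmpty (K 1 →+* K 0))
    (e : K 2 ≃+* K 0) {Φ : ∀ j, CMType (K j)} (hsep : CMAlgebra.IsSeparatingFamily Φ) (p : ℕ) :
    (pohlmannSetsAlg Φ p \ pohlmannDivisorSetsAlg Φ p).Nonempty ↔ 2 ≤ p ∧ p ≤ 4 := by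
  have hN := card_sigma_eq_twelve h4₀ h4₁ e
  constructor
  · intro h
    by_contra hp
    have hp' : p ≤ 1 ∨ 6 ≤ p + 1 := by omega
    rw [diff_eq_empty_of_degree hsep hN hp'] at h
    exact Set.not_nonempty_empty h
  · rintro ⟨h2, h4⟩
    obtain ⟨S, hS⟩ := pohlmannSetsAlg_two_diff_nonempty h4₀ hK₀ h4₁ hK₁ hMK hne e hsep
    interval_cases p
    · exact ⟨S, hS⟩
    · -- a conjugate pair avoiding `S` (`S` meets at most `4` of the `12` points, pairs are disjoint)
      have hcard : S.card = 4 := hS.1.1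
      obtain ⟨y, hy⟩ : ∃ y : (j : Fin 3) × (K j →+* ℂ),
          y ∉ S ∪ (starRingAut : ℂ ≃+* ℂ) • S := by
        by_contra h
        push Not at h
        have hle : (Finset.univ : Finset ((j : Fin 3) × (K j →+* ℂ))).card ≤
            (S ∪ (starRingAut : ℂ ≃+* ℂ) • S).card :=
          Finset.card_le_card fun y _ => h y
        rw [Finset.card_univ, hN] at hle
        have := (Finset.card_union_le S ((starRingAut : ℂ ≃+* ℂ) • S)).trans_eq
          (by rw [Finset.card_smul_finset, hcard])
        omega
      rw [Finset.mem_union, not_or] at hy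
      refine ⟨_, union_pair_mem_diff hsep hS hy.1 fun h => hy.2 ?_⟩
      rw [← conj_smul_conj_smul y]
      exact Finset.smul_mem_smul_finset h
    · have h := compl_mem_diff hsep hN hS
      exact ⟨_, h⟩

end Triple
/-! ### §3 On abelian varieties: exceptional classes on `S₁ × S₂ × S₁′` exactly in `H⁴, H⁶, H⁸` -/

section Geometry

variable {K : Fin 3 → Type} [∀ j, Field (K j)] [∀ j, NumberField (K j)] [∀ j, IsCMField (K j)]
  {Φ : ∀ j, CMType (K j)} {A : Fin 3 → AbelianVariety ℂ} {ι : ∀ j, 𝓞 (K j) →+* End (A j)}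
  {θ : ∀ j, K j →+* Module.End ℂ (complexBetti (A j).X 1)}

/-- **Exceptional Hodge classes on the dihedral surface triple live exactly in `H⁴, H⁶, H⁸`.**  For every family of
realisations `A` of a separating three-slot family as in `DihedralReflexTripleCMHodge.exists_exceptional_two_biproduct`: a
rational class of Hodge type `(p,p)` on `⨁ A = S₁ × S₂ × S₁′` outside the `ℂ`-span `Dᵖ ⊗ ℂ` of products of divisor classes
exists iff `2 ≤ p ≤ 4` (Pohlmann's criterion `exists_exceptional_biproduct_iff` and the degree profile
`diff_nonempty_iff`). [cite: Pohlmann1968, Thm. 1] [cite: Gordon1999HodgeAVSurvey, 9.2.2 and §9.3]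
[cite: MoonenZarhin1999LowDim, "Hodge groups of simple abelian surfaces of CM-type"] -/
theorem exists_exceptional_biproduct_iff_degree (h4₀ : Module.finrank ℚ (K 0) = 4) (hK₀ : ¬IsGalois ℚ (K 0))
    (h4₁ : Module.finrank ℚ (K 1) = 4) (hK₁ : ¬IsGalois ℚ (K 1))
    (hMK : ∀ (t : K 1 →+* ℂ) (y : K 1), t y ∈ normalClosure ℚ (K 0) ℂ) (hne : IsEmpty (K 1 →+* K 0))
    (e : K 2 ≃+* K 0) (hsep : CMAlgebra.IsSeparatingFamily Φ)
    (hA : ∀ j, IsCMTypeRealisation (Φ j) (A j) (ι j) (θ j)) (p : ℕ) :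
    (∃ c : complexBetti (⨁ A).X (2 * p), IsRationalClass c ∧
      IsOfHodgeType (⨁ A).dim (⨁ A).X (2 * p) p p c ∧ c ∉ divisorClassesSpan (⨁ A).X (⨁ A).dim p) ↔
      2 ≤ p ∧ p ≤ 4 := by
  rw [Literature.AlgebraicGeometry.Pohlmann1968.exists_exceptional_biproduct_iff hA p]
  exact diff_nonempty_iff h4₀ hK₀ h4₁ hK₁ hMK hne e hsep p

/-- **`Bᵖ ⊗ ℂ = Dᵖ ⊗ ℂ` on `S₁ × S₂ × S₁′` for `p ≤ 1` and `p ≥ 5`**: outside the degrees `2, 3, 4` the rational `(p,p)`-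
classes of the triple are spanned by products of divisor classes (only `[K₀:ℚ] = [K₁:ℚ] = 4`, `K₂ ≃ K₀` and Kubota
separation are used). [cite: Pohlmann1968, Thm. 1] [cite: Gordon1999HodgeAVSurvey, 9.2.2] -/
theorem hodgeClassSpan_eq_divisorClassesSpan (h4₀ : Module.finrank ℚ (K 0) = 4) (h4₁ : Module.finrank ℚ (K 1) = 4)
    (e : K 2 ≃+* K 0) (hsep : CMAlgebra.IsSeparatingFamily Φ) (hA : ∀ j, IsCMTypeRealisation (Φ j) (A j) (ι j) (θ j))
    {p : ℕ} (hp : p ≤ 1 ∨ 5 ≤ p) :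
    hodgeClassSpan (⨁ A).dim (⨁ A).X p = divisorClassesSpan (⨁ A).X (⨁ A).dim p := by
  have hempty : pohlmannSetsAlg Φ p \ pohlmannDivisorSetsAlg Φ p = ∅ :=
    diff_eq_empty_of_degree hsep (card_sigma_eq_twelve h4₀ h4₁ e) (by omega)
  have hsub : pohlmannSetsAlg Φ p ⊆ pohlmannDivisorSetsAlg Φ p := Set.sdiff_eq_empty.1 hempty
  refine le_antisymm ?_ (divisorClassesSpan_biproduct_le_hodgeClassSpan hA p)
  rw [divisorClassesSpan_biproduct_eq_iSup hA p, (Pohlmann1968_thm1_cmAlgebra K A Φ ι θ hA p).1]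
  exact iSup₂_le fun S hS => le_iSup₂_of_le S (hsub hS) le_rfl

/-- **Hodge classes of `S₁ × S₂ × S₁′` in degrees `p ≤ 1` and `p ≥ 5` are algebraic** (they are products of divisor
classes, and Lefschetz `(1,1)` — the tree's theorem `lefschetzOneOne_rational_holds`), UNCONDITIONALLY.
[cite: Gordon1999HodgeAVSurvey, 9.2.2 and 10.10] [cite: Pohlmann1968, Thm. 1] -/
theorem hodgeClasses_algebraic_of_degree (h4₀ : Module.finrank ℚ (K 0) = 4) (h4₁ : Module.finrank ℚ (K 1) = 4)
    (e : K 2 ≃+* K 0) (hsep : CMAlgebra.IsSeparatingFamily Φ) (hA : ∀ j, IsCMTypeRealisation (Φ j) (A j) (ι j) (θ j))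
    {p : ℕ} (hp : p ≤ 1 ∨ 5 ≤ p) (c : complexBetti (⨁ A).X (2 * p)) (hc : IsRationalClass c)
    (hpp : IsOfHodgeType (⨁ A).dim (⨁ A).X (2 * p) p p c) : c ∈ algebraicClasses (⨁ A).X p := by
  refine AbelianVariety.divisorClassesSpan_le_algebraicClasses (⨁ A)
    (fun b hb hb' ↦ lefschetzOneOne_rational_holds
      (Literature.AlgebraicGeometry.Motives.AbelianVariety.isSmoothProjective_holds (A := ⨁ A)) b hb hb') p ?_
  rw [← hodgeClassSpan_eq_divisorClassesSpan h4₀ h4₁ e hsep hA hp]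
  exact Submodule.subset_span ⟨hc, hpp⟩

/-- **The Hodge conjecture for `S₁ × S₂ × S₁′` is exactly the algebraicity of its Hodge classes in `H⁴, H⁶, H⁸`**: all
other degrees are settled by divisors. (Those middle classes include the exceptional ones of `diff_nonempty_iff`; their
algebraicity is open.) [cite: Gordon1999HodgeAVSurvey, 9.2.2 and 10.10] [cite: MoonenZarhin1999LowDim, "Hodge groups of
simple abelian surfaces of CM-type"] -/
theorem hodgeConjectureFor_iff_middle_degrees (h4₀ : Module.finrank ℚ (K 0) = 4) (h4₁ : Module.finrank ℚ (K 1) = 4)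
    (e : K 2 ≃+* K 0) (hsep : CMAlgebra.IsSeparatingFamily Φ)
    (hA : ∀ j, IsCMTypeRealisation (Φ j) (A j) (ι j) (θ j)) :
    HodgeConjectureFor (⨁ A).dim (⨁ A).X ↔
      ∀ p : ℕ, 2 ≤ p → p ≤ 4 → ∀ c : complexBetti (⨁ A).X (2 * p), IsRationalClass c →
        IsOfHodgeType (⨁ A).dim (⨁ A).X (2 * p) p p c → c ∈ algebraicClasses (⨁ A).X p := by
  refine ⟨fun h p _ _ c hc hpp => h.2 p c hc hpp, fun h => ⟨nonempty_hodgeModel_holds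
    (Literature.AlgebraicGeometry.Motives.AbelianVariety.isSmoothProjective_holds (A := ⨁ A)), fun p c hc hpp => ?_⟩⟩
  by_cases hp : 2 ≤ p ∧ p ≤ 4
  · exact h p hp.1 hp.2 c hc hpp
  · exact hodgeClasses_algebraic_of_degree h4₀ h4₁ e hsep hA (by omega) c hc hpp

end Geometry

end DihedralReflexTriple

end Summit.HodgeConjecture.CorCM

end
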